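import Mathlib
import Summits.AtomisticToContinuum.Crystallization.Theses.PhononSlackCertificates
import Summits.AtomisticToContinuum.Crystallization.Theorems.PhononSlackCertificatesNearFarGlueRSlab
import Summits.AtomisticToContinuum.Crystallization.Theorems.PhononSlackCertificatesNearFarGlueRBox
import Summits.AtomisticToContinuum.Crystallization.Theorems.PhononSlackCertificatesNearFarGlueRExtremeLayer
import Literature.MathematicalPhysics.StatisticalMechanics.LennardJonesClusters

/-!
# Crux `PhononSlackCertificates.NearFarGlueR` (stmt-AtomisticToContinuum-14970), line `Sketch`:
the BOUNDING-BOX species — every finite configuration pays for its six extreme layers at once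

Continuation lead c5.  The box form of the mirror principle (`stub_boxMirror`,
`Theorems/PhononSlackCertificatesNearFarGlueRBox.lean`: particles in an axis-aligned box with
margins `9/20` satisfy `N·e* ≤ 𝓔(x) + ½·Σ_i Σ_a [V(2(x_i^a − ℓ_a)) + V(2(u_a − x_i^a))]`) applies
to EVERY finite configuration with the bounding box enlarged by `9/20`; every one of the `6N`
terms is `≤ 0`, and a particle within `D − 9/20` of a face of the bounding box has a term
`≤ V(2D)` (`lennardJones_le_far_end` of `…NearFarGlueRExtremeLayer.lean`, `D ≥ 3/4`).  Hence the hypothesis-free species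

* `boundingBox_gap` (= registered sub-goal `stub_boundingBox`): for every finite injective `x`,
  all coordinate bounds `ℓ_a ≤ x_i^a ≤ u_a` and every `D ≥ 3/4`,
  `N·e* + ½(−V(2D))·#{i : ∃ a, x_i^a − ℓ_a ≤ D − 9/20 ∨ u_a − x_i^a ≤ D − 9/20} ≤ 𝓔_LJ(x)`;
  at `D = 3/4` the six `3/10`-thick extreme layers pay `≥ 1/150` per particle, simultaneously.

* `slabLayers_gap`: the same from the slab form (`stub_slabMirror`,
  `Theorems/PhononSlackCertificatesNearFarGlueRSlab.lean`) in an ARBITRARY direction `n`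
  (`‖n‖ = 1`, `m ≤ ⟪x_i, n⟫ ≤ M`): the particles within `D − 9/20` of the bottom OR the top pay
  `½(−V(2D))` each, simultaneously.

* `excess_ge_one_div`: hence EVERY non-empty finite configuration has excess energy
  `𝓔_LJ(x) − N·e* ≥ 1/150` (its extreme particle in a fixed direction pays); in particular
  `E(N) − N·e* ≥ 1/150` for all `N ≥ 1`.

No separation, no goodness, no lattice, no cone on `e*`.  All `[folklore]`.
-/

noncomputable section

namespace Summit.AtomisticToContinuum.Crystallization.Theorems.PhononSlackCertificatesNearFarGlueR

open Literature.MathematicalPhysics.StatisticalMechanics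
open Literature.Geometry.DiscreteGeometry
open Summit.AtomisticToContinuum.Crystallization.Theses.PhononSlackCertificates
open scoped BigOperators RealInnerProductSpace

/-! ## §1 The bounding box pays -/

/-- One particle's six box terms: all `≤ 0`, and `≤ V(2D)` in total as soon as the particle is
within `D − 9/20` of one face (box enlarged by the margin `9/20`). [folklore] -/
theorem box_terms_le {ℓ u : Fin 3 → ℝ} {D : ℝ} (hD : 3 / 4 ≤ D) (p : EuclideanSpace ℝ (Fin 3))
    (hp : ∀ a : Fin 3, ℓ a ≤ p a ∧ p a ≤ u a)
    (hnear : ∃ a : Fin 3, p a - ℓ a ≤ D - 9 / 20 ∨ u a - p a ≤ D - 9 / 20) :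
    ∑ a : Fin 3, (lennardJones (2 * (p a - (ℓ a - 9 / 20))) +
        lennardJones (2 * (u a + 9 / 20 - p a))) ≤ lennardJones (2 * D) := by
  obtain ⟨a, ha⟩ := hnear
  rw [← Finset.add_sum_erase _ _ (Finset.mem_univ a)]
  have hrest : ∑ b ∈ Finset.univ.erase a, (lennardJones (2 * (p b - (ℓ b - 9 / 20))) +
      lennardJones (2 * (u b + 9 / 20 - p b))) ≤ 0 :=
    Finset.sum_nonpos fun b _ => add_nonpos
      (lennardJones_nonpos_of_ge_nine_tenths (by linarith [(hp b).1]))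
      (lennardJones_nonpos_of_ge_nine_tenths (by linarith [(hp b).2]))
  have h1 : lennardJones (2 * (p a - (ℓ a - 9 / 20))) ≤ 0 :=
    lennardJones_nonpos_of_ge_nine_tenths (by linarith [(hp a).1])
  have h2 : lennardJones (2 * (u a + 9 / 20 - p a)) ≤ 0 :=
    lennardJones_nonpos_of_ge_nine_tenths (by linarith [(hp a).2])
  rcases ha with ha | ha
  · have : lennardJones (2 * (p a - (ℓ a - 9 / 20))) ≤ lennardJones (2 * D) :=
      lennardJones_le_far_end (by linarith [(hp a).1]) (by linarith) hD
    linarith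
  · have : lennardJones (2 * (u a + 9 / 20 - p a)) ≤ lennardJones (2 * D) :=
      lennardJones_le_far_end (by linarith [(hp a).2]) (by linarith) hD
    linarith

/-- One particle's six box terms are `≤ 0` (box enlarged by the margin). [folklore] -/
theorem box_terms_nonpos {ℓ u : Fin 3 → ℝ} (p : EuclideanSpace ℝ (Fin 3))
    (hp : ∀ a : Fin 3, ℓ a ≤ p a ∧ p a ≤ u a) :
    ∑ a : Fin 3, (lennardJones (2 * (p a - (ℓ a - 9 / 20))) +
        lennardJones (2 * (u a + 9 / 20 - p a))) ≤ 0 :=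
  Finset.sum_nonpos fun b _ => add_nonpos
    (lennardJones_nonpos_of_ge_nine_tenths (by linarith [(hp b).1]))
    (lennardJones_nonpos_of_ge_nine_tenths (by linarith [(hp b).2]))

open scoped Classical in
/-- **Bounding-box species.**  For every finite injective configuration `x` of `ℝ³`, all
coordinate bounds `ℓ_a ≤ x_i^a ≤ u_a` and every `D ≥ 3/4`:
`N·e* + ½(−V(2D))·#{i : ∃ a, x_i^a − ℓ_a ≤ D − 9/20 ∨ u_a − x_i^a ≤ D − 9/20} ≤ 𝓔_LJ(x)` — the
box mirror principle for the box enlarged by `9/20`. [folklore] -/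
theorem boundingBox_gap {N : ℕ} (x : Fin N → EuclideanSpace ℝ (Fin 3))
    (hx : Function.Injective x) {ℓ u : Fin 3 → ℝ} {D : ℝ}
    (hbox : ∀ (i : Fin N) (a : Fin 3), ℓ a ≤ x i a ∧ x i a ≤ u a) (hD : 3 / 4 ≤ D) :
    (N : ℝ) * (⨅ Q : PeriodicConfiguration 3, Q.energyPerParticle lennardJones) +
      (1 / 2 : ℝ) * (-lennardJones (2 * D)) *
        (Nat.card {i : Fin N // ∃ a : Fin 3, x i a - ℓ a ≤ D - 9 / 20 ∨ u a - x i a ≤ D - 9 / 20} : ℝ)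
        ≤ interactionEnergy lennardJones x := by
  have hB := stub_boxMirror N x hx (fun a => ℓ a - 9 / 20) (fun a => u a + 9 / 20)
    (fun i a => ⟨by linarith [(hbox i a).1], by linarith [(hbox i a).2]⟩)
  set P : Fin N → Prop := fun i => ∃ a : Fin 3, x i a - ℓ a ≤ D - 9 / 20 ∨ u a - x i a ≤ D - 9 / 20
    with hP
  set S := Finset.univ.filter P with hS
  have hcard : (Nat.card {i : Fin N // P i} : ℝ) = S.card := by
    rw [Nat.card_eq_fintype_card, Fintype.card_subtype, hS]
  set f : Fin N → ℝ := fun i => ∑ a : Fin 3, (lennardJones (2 * (x i a - (ℓ a - 9 / 20))) +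
      lennardJones (2 * (u a + 9 / 20 - x i a))) with hf
  have hsplit := Finset.sum_filter_add_sum_filter_not Finset.univ P f
  have hin : ∑ i ∈ S, f i ≤ ∑ i ∈ S, lennardJones (2 * D) :=
    Finset.sum_le_sum fun i hi => box_terms_le hD (x i) (hbox i) (Finset.mem_filter.1 hi).2
  have hout : ∑ i ∈ Finset.univ.filter (fun i => ¬ P i), f i ≤ 0 :=
    Finset.sum_nonpos fun i _ => box_terms_nonpos (x i) (hbox i)
  rw [Finset.sum_const, nsmul_eq_mul] at hin
  rw [← hS] at hsplit
  change (N : ℝ) * _ + _ * (Nat.card {i : Fin N // P i} : ℝ) ≤ _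
  rw [hcard]
  have hsum : ∑ i, f i ≤ (S.card : ℝ) * lennardJones (2 * D) := by linarith
  have hB' : (N : ℝ) * (⨅ Q : PeriodicConfiguration 3, Q.energyPerParticle lennardJones) ≤
      interactionEnergy lennardJones x + (1 / 2 : ℝ) * ∑ i, f i := hB
  nlinarith

/-- **Registered sub-goal `stub_boundingBox` of the line `Sketch`** (the bounding-box species in
closed form). [folklore] -/
theorem stub_boundingBox :
    ∀ (N : ℕ) (x : Fin N → EuclideanSpace ℝ (Fin 3)), Function.Injective x →
    ∀ (ℓ u : Fin 3 → ℝ) (D : ℝ), (∀ (i : Fin N) (a : Fin 3), ℓ a ≤ x i a ∧ x i a ≤ u a) →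
      3 / 4 ≤ D →
      (N : ℝ) * (⨅ Q : PeriodicConfiguration 3, Q.energyPerParticle lennardJones) +
        (1 / 2 : ℝ) * (-lennardJones (2 * D)) *
          (Nat.card {i : Fin N // ∃ a : Fin 3, x i a - ℓ a ≤ D - 9 / 20 ∨
            u a - x i a ≤ D - 9 / 20} : ℝ)
        ≤ interactionEnergy lennardJones x :=
  fun _ x hx _ _ _ hbox hD => boundingBox_gap x hx hbox hD

open scoped Classical in
/-- **The six extreme layers pay `1/150` per particle, simultaneously**: for every finite
injective `x` and coordinate bounds `ℓ_a ≤ x_i^a ≤ u_a`,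
`N·e* + (1/150)·#{i : ∃ a, x_i^a ≤ ℓ_a + 3/10 ∨ u_a − 3/10 ≤ x_i^a} ≤ 𝓔_LJ(x)`. [folklore] -/
theorem boundingBox_gap_three_tenths {N : ℕ} (x : Fin N → EuclideanSpace ℝ (Fin 3))
    (hx : Function.Injective x) {ℓ u : Fin 3 → ℝ}
    (hbox : ∀ (i : Fin N) (a : Fin 3), ℓ a ≤ x i a ∧ x i a ≤ u a) :
    (N : ℝ) * (⨅ Q : PeriodicConfiguration 3, Q.energyPerParticle lennardJones) +
      (1 / 150 : ℝ) * (Nat.card {i : Fin N // ∃ a : Fin 3, x i a ≤ ℓ a + 3 / 10 ∨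
          u a - 3 / 10 ≤ x i a} : ℝ)
        ≤ interactionEnergy lennardJones x := by
  have h := boundingBox_gap x hx hbox (le_refl (3 / 4 : ℝ))
  have he : ∀ i : Fin N, (∃ a : Fin 3, x i a - ℓ a ≤ 3 / 4 - 9 / 20 ∨ u a - x i a ≤ 3 / 4 - 9 / 20) ↔
      (∃ a : Fin 3, x i a ≤ ℓ a + 3 / 10 ∨ u a - 3 / 10 ≤ x i a) := fun i => by
    constructor
    · rintro ⟨a, ha | ha⟩
      · exact ⟨a, Or.inl (by linarith)⟩
      · exact ⟨a, Or.inr (by linarith)⟩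
    · rintro ⟨a, ha | ha⟩
      · exact ⟨a, Or.inl (by linarith)⟩
      · exact ⟨a, Or.inr (by linarith)⟩
  have hcard : (Nat.card {i : Fin N // ∃ a : Fin 3, x i a - ℓ a ≤ 3 / 4 - 9 / 20 ∨
        u a - x i a ≤ 3 / 4 - 9 / 20} : ℝ) =
      (Nat.card {i : Fin N // ∃ a : Fin 3, x i a ≤ ℓ a + 3 / 10 ∨ u a - 3 / 10 ≤ x i a} : ℝ) := by
    rw [Nat.card_eq_fintype_card, Nat.card_eq_fintype_card, Fintype.card_subtype,
      Fintype.card_subtype]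
    congr 2
    exact Finset.filter_congr fun i _ => he i
  rw [hcard] at h
  have hc : (0 : ℝ) ≤ (Nat.card {i : Fin N // ∃ a : Fin 3, x i a ≤ ℓ a + 3 / 10 ∨
      u a - 3 / 10 ≤ x i a} : ℝ) := by positivity
  nlinarith [one_div_le_half_neg_lennardJones_three_halves, hc]

open scoped Classical in
/-- **The bounding-box species in the residual's currency**: in every finite injective
configuration with coordinate bounds `ℓ_a ≤ x_i^a ≤ u_a`, the tight contacts of the six
`3/10`-thick extreme layers pay `1/150` each, simultaneously. [folklore] -/
theorem tightContact_ineq_boundingBox {N : ℕ} (x : Fin N → EuclideanSpace ℝ (Fin 3))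
    (hx : Function.Injective x) {ℓ u : Fin 3 → ℝ}
    (hbox : ∀ (i : Fin N) (a : Fin 3), ℓ a ≤ x i a ∧ x i a ≤ u a) :
    (N : ℝ) * (⨅ Q : PeriodicConfiguration 3, Q.energyPerParticle lennardJones) +
      (1 / 150 : ℝ) * (Nat.card {j : Fin N //
          (¬ IsTwoShellGood (1 / 20) (47 / 50) 1 x j ∧
            ∃ i : Fin N, IsTwoShellGood (1 / 20) (47 / 50) 1 x i ∧ dist (x i) (x j) ≤ 21 / 20) ∧
          ∃ a : Fin 3, x j a ≤ ℓ a + 3 / 10 ∨ u a - 3 / 10 ≤ x j a} : ℝ)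
        ≤ interactionEnergy lennardJones x := by
  have h := boundingBox_gap_three_tenths x hx hbox
  have hle : Nat.card {j : Fin N //
          (¬ IsTwoShellGood (1 / 20) (47 / 50) 1 x j ∧
            ∃ i : Fin N, IsTwoShellGood (1 / 20) (47 / 50) 1 x i ∧ dist (x i) (x j) ≤ 21 / 20) ∧
          ∃ a : Fin 3, x j a ≤ ℓ a + 3 / 10 ∨ u a - 3 / 10 ≤ x j a} ≤
      Nat.card {i : Fin N // ∃ a : Fin 3, x i a ≤ ℓ a + 3 / 10 ∨ u a - 3 / 10 ≤ x i a} := by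
    rw [Nat.card_eq_fintype_card, Nat.card_eq_fintype_card]
    refine Fintype.card_le_of_injective (fun j => ⟨j.1, j.2.2⟩) fun a b hab => ?_
    have hval := congrArg
      (fun z : {i : Fin N // ∃ a : Fin 3, x i a ≤ ℓ a + 3 / 10 ∨ u a - 3 / 10 ≤ x i a} => z.1) hab
    exact Subtype.ext (by simpa using hval)
  have hcast : (Nat.card {j : Fin N //
          (¬ IsTwoShellGood (1 / 20) (47 / 50) 1 x j ∧
            ∃ i : Fin N, IsTwoShellGood (1 / 20) (47 / 50) 1 x i ∧ dist (x i) (x j) ≤ 21 / 20) ∧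
          ∃ a : Fin 3, x j a ≤ ℓ a + 3 / 10 ∨ u a - 3 / 10 ≤ x j a} : ℝ) ≤
      (Nat.card {i : Fin N // ∃ a : Fin 3, x i a ≤ ℓ a + 3 / 10 ∨ u a - 3 / 10 ≤ x i a} : ℝ) := by
    exact_mod_cast hle
  nlinarith

/-! ## §2 Both extreme layers in an arbitrary direction -/

open scoped Classical in
/-- **Slab-layers species.**  For every finite injective configuration `x` of `ℝ³`, every unit
vector `n`, all bounds `m ≤ ⟪x_i, n⟫ ≤ M` and every `D ≥ 3/4`:
`N·e* + ½(−V(2D))·#{i : ⟪x_i, n⟫ ≤ m + D − 9/20 ∨ M − (D − 9/20) ≤ ⟪x_i, n⟫} ≤ 𝓔_LJ(x)` — the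
slab mirror principle for the planes `⟪p, n⟫ = m − 9/20` and `⟪p, n⟫ = M + 9/20`. [folklore] -/
theorem slabLayers_gap {N : ℕ} (x : Fin N → EuclideanSpace ℝ (Fin 3))
    (hx : Function.Injective x) {n : EuclideanSpace ℝ (Fin 3)} (hn : ‖n‖ = 1) {m M D : ℝ}
    (hmM : ∀ i : Fin N, m ≤ ⟪x i, n⟫ ∧ ⟪x i, n⟫ ≤ M) (hD : 3 / 4 ≤ D) :
    (N : ℝ) * (⨅ Q : PeriodicConfiguration 3, Q.energyPerParticle lennardJones) +
      (1 / 2 : ℝ) * (-lennardJones (2 * D)) *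
        (Nat.card {i : Fin N // ⟪x i, n⟫ ≤ m + (D - 9 / 20) ∨ M - (D - 9 / 20) ≤ ⟪x i, n⟫} : ℝ)
        ≤ interactionEnergy lennardJones x := by
  have hS' := stub_slabMirror N x hx n hn (m - 9 / 20) (M + 9 / 20)
    (fun i => by linarith [(hmM i).1]) (fun i => by linarith [(hmM i).2])
  set P : Fin N → Prop := fun i => ⟪x i, n⟫ ≤ m + (D - 9 / 20) ∨ M - (D - 9 / 20) ≤ ⟪x i, n⟫
    with hP
  set S := Finset.univ.filter P with hS
  have hcard : (Nat.card {i : Fin N // P i} : ℝ) = S.card := by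
    rw [Nat.card_eq_fintype_card, Fintype.card_subtype, hS]
  set f : Fin N → ℝ := fun i => lennardJones (2 * (⟪x i, n⟫ - (m - 9 / 20))) +
      lennardJones (2 * (M + 9 / 20 - ⟪x i, n⟫)) with hf
  have h1 : ∀ i : Fin N, lennardJones (2 * (⟪x i, n⟫ - (m - 9 / 20))) ≤ 0 := fun i =>
    lennardJones_nonpos_of_ge_nine_tenths (by linarith [(hmM i).1])
  have h2 : ∀ i : Fin N, lennardJones (2 * (M + 9 / 20 - ⟪x i, n⟫)) ≤ 0 := fun i =>
    lennardJones_nonpos_of_ge_nine_tenths (by linarith [(hmM i).2])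
  have hsplit := Finset.sum_filter_add_sum_filter_not Finset.univ P f
  have hin : ∑ i ∈ S, f i ≤ ∑ i ∈ S, lennardJones (2 * D) :=
    Finset.sum_le_sum fun i hi => by
      rcases (Finset.mem_filter.1 hi).2 with hi' | hi'
      · have : lennardJones (2 * (⟪x i, n⟫ - (m - 9 / 20))) ≤ lennardJones (2 * D) :=
          lennardJones_le_far_end (by linarith [(hmM i).1]) (by linarith) hD
        simp only [hf]; linarith [h2 i]
      · have : lennardJones (2 * (M + 9 / 20 - ⟪x i, n⟫)) ≤ lennardJones (2 * D) :=
          lennardJones_le_far_end (by linarith [(hmM i).2]) (by linarith) hD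
        simp only [hf]; linarith [h1 i]
  have hout : ∑ i ∈ Finset.univ.filter (fun i => ¬ P i), f i ≤ 0 :=
    Finset.sum_nonpos fun i _ => add_nonpos (h1 i) (h2 i)
  rw [Finset.sum_const, nsmul_eq_mul] at hin
  rw [← hS] at hsplit
  change (N : ℝ) * _ + _ * (Nat.card {i : Fin N // P i} : ℝ) ≤ _
  rw [hcard]
  have hsum : ∑ i, f i ≤ (S.card : ℝ) * lennardJones (2 * D) := by linarith
  have hB' : (N : ℝ) * (⨅ Q : PeriodicConfiguration 3, Q.energyPerParticle lennardJones) ≤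
      interactionEnergy lennardJones x + (1 / 2 : ℝ) * ∑ i, f i := by
    simpa only [hf] using hS'
  nlinarith

/-! ## §3 A universal quantum of excess energy -/

/-- **Every non-empty finite configuration has excess energy at least `1/150`**:
`N·e* + 1/150 ≤ 𝓔_LJ(x)` for every injective `x : Fin N → ℝ³`, `N ≥ 1` — the particle that is
extreme in a fixed direction lies in its own `3/10`-thick extreme layer
(`extremeLayer_gap_three_tenths`).  In particular `E(N) − N·e* ≥ 1/150` for all `N ≥ 1`.
[folklore] -/
theorem excess_ge_one_div {N : ℕ} (hN : 1 ≤ N) (x : Fin N → EuclideanSpace ℝ (Fin 3))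
    (hx : Function.Injective x) :
    (N : ℝ) * (⨅ Q : PeriodicConfiguration 3, Q.energyPerParticle lennardJones) + 1 / 150
        ≤ interactionEnergy lennardJones x := by
  classical
  set n : EuclideanSpace ℝ (Fin 3) := EuclideanSpace.single 0 1 with hn_def
  have hn : ‖n‖ = 1 := by rw [hn_def, PiLp.norm_single, norm_one]
  have hne : (Finset.univ : Finset (Fin N)).Nonempty :=
    Finset.univ_nonempty_iff.2 ⟨⟨0, by omega⟩⟩
  obtain ⟨i₀, -, hi₀⟩ := Finset.exists_max_image Finset.univ (fun i => ⟪x i, n⟫) hne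
  have hM : ∀ i : Fin N, ⟪x i, n⟫ ≤ ⟪x i₀, n⟫ := fun i => hi₀ i (Finset.mem_univ i)
  have h := extremeLayer_gap_three_tenths x hx hn hM
  have hone : (1 : ℝ) ≤ (Nat.card {i : Fin N // ⟪x i₀, n⟫ - 3 / 10 ≤ ⟪x i, n⟫} : ℝ) := by
    have hfin : 1 ≤ Nat.card {i : Fin N // ⟪x i₀, n⟫ - 3 / 10 ≤ ⟪x i, n⟫} := by
      rw [Nat.card_eq_fintype_card, Nat.one_le_iff_ne_zero, ← Nat.pos_iff_ne_zero,
        Fintype.card_pos_iff]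
      exact ⟨⟨i₀, by linarith⟩⟩
    exact_mod_cast hfin
  linarith

end Summit.AtomisticToContinuum.Crystallization.Theorems.PhononSlackCertificatesNearFarGlueR

end
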